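import Literature.Analysis.FluidPDE.SereginSverakBlowup
import Literature.Analysis.FluidPDE.SereginSverakBlowupSelection
import Literature.Analysis.FluidPDE.SereginSverakBlowupExtraction
import Literature.Analysis.FluidPDE.AxisymmetricVorticityTransport
import HarnessLib

/-!
# Seregin–Šverák 2009, §4: continuous representatives on the cylinders `Q(R)` (elementary lemmas)

Support file for the compactness step (iv) of G. Seregin, V. Šverák, *On Type I singularities
of the local axi-symmetric solutions of the Navier–Stokes equations*, Comm. PDE 34 (2009) =
arXiv:0804.1803, §4 (arXiv p. 11), in the vocabulary of `SereginSverakAxisymmetric` /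
`SereginSverakBlowup` (`parCyl`, `parCylTop`, `spaceCyl`). The hypotheses of
`SereginSverak2009.BlowupCompactness` are almost-everywhere statements about the rescaled fields
`u^k` on the open cylinders `Q(R_k)` ((p2), (p5), axial symmetry) together with a representative
`V_k` continuous on the half-closed cylinder `𝒞(R_k) × ]-R_k², 0]`; the printed argument works
with continuous functions throughout. This file proves the bookkeeping in full:

* geometry: the compact cylinders-with-top `[-ρ², 0] × {|x'| ≤ ρ, |x₃| ≤ ρ}` on which
  Arzelà–Ascoli is run (`isCompact_closedTop`), their position inside `Q(r)`, `𝒞(R) × ]-R², 0]`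
  and `closure Q(r)` (`closedTop_subset_parCylTop`, `closedTop_subset_closure_parCyl`,
  `parCylTop_subset_closure_parCyl`), neighbourhoods inside the closed half-space `{s ≤ 0}`
  (`closedTop_mem_nhdsWithin`), and compact subsets of the open half-space inside some `Q(n+1)`
  (`exists_nat_subset_parCyl`);
* a.e. to everywhere: a.e. closed conditions on an open set hold at every point for functions
  continuous there (`forall_mem_of_ae_mem_of_continuousOn`), whence the bounds `|V_k| ≤ 1`,
  `|x'| |V_k| ≤ A₂` and the axial symmetry `V_k(s, R_θ y) = R_θ V_k(s, y)` hold at every point of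
  `𝒞(R_k) × ]-R_k², 0]` (`norm_repr_le`, `cylRadius_mul_norm_repr_le`, `repr_rotZ`; the last one
  by the invariance of Lebesgue measure under `(s, y) ↦ (s, R_θ y)`);
* the Hölder modulus delivered on an open `Q(r)` by `SereginSverak2009.LocalHolderBound` for
  SOME representative is a modulus for `V_k` on the compact cylinder-with-top of any size
  `ρ < r` (`dist_repr_le_of_holderOnWith`).

## References

* G. Seregin, V. Šverák, Comm. PDE 34 (2009), arXiv:0804.1803, §4 p. 11. [`SereginSverak2009`]
-/

noncomputable section

open MeasureTheory Set Function Filter Topology TopologicalSpace Metric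
open scoped NNReal ENNReal

namespace Literature.Analysis.FluidPDE

namespace SereginSverak2009

/-! ### Geometry of the cylinders -/

/-- The compact cylinder-with-top `[-ρ², 0] × {|x'| ≤ ρ, |x₃| ≤ ρ}` is compact. [folklore] -/
theorem isCompact_closedTop (ρ : ℝ) :
    IsCompact (Icc (-ρ ^ 2) 0 ×ˢ
      {x : EuclideanSpace ℝ (Fin 3) | cylRadius x ≤ ρ ∧ |x 2| ≤ ρ}) := by
  refine isCompact_Icc.prod (Metric.isCompact_of_isClosed_isBounded ?_ ?_)
  · have h1 : Continuous fun x : EuclideanSpace ℝ (Fin 3) => |x 2| := by fun_prop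
    exact (isClosed_le continuous_cylRadius continuous_const).inter
      (isClosed_le h1 continuous_const)
  · refine isBounded_iff_forall_norm_le.2 ⟨ρ + ρ, fun x hx => ?_⟩
    exact (norm_le_cylRadius_add_abs x).trans (add_le_add hx.1 hx.2)

/-- `Q(ρ) ⊆ [-ρ², 0] × {|x'| ≤ ρ, |x₃| ≤ ρ}`. [folklore] -/
theorem parCyl_subset_closedTop (ρ : ℝ) :
    parCyl 0 ρ ⊆ Icc (-ρ ^ 2) 0 ×ˢ
      {x : EuclideanSpace ℝ (Fin 3) | cylRadius x ≤ ρ ∧ |x 2| ≤ ρ} := by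
  intro z hz
  rw [mem_parCyl_zero] at hz
  exact ⟨⟨hz.1.1.le, hz.1.2.le⟩, hz.2.1.le, hz.2.2.le⟩

/-- `[-ρ², 0] × {|x'| ≤ ρ, |x₃| ≤ ρ} ⊆ 𝒞(R) × ]-R², 0]` for `0 ≤ ρ < R`. [folklore] -/
theorem closedTop_subset_parCylTop {ρ R : ℝ} (hρ : 0 ≤ ρ) (h : ρ < R) :
    Icc (-ρ ^ 2) 0 ×ˢ {x : EuclideanSpace ℝ (Fin 3) | cylRadius x ≤ ρ ∧ |x 2| ≤ ρ} ⊆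
      parCylTop R := by
  intro z hz
  have h2 : ρ ^ 2 < R ^ 2 := pow_lt_pow_left₀ h hρ two_ne_zero
  refine (mem_parCylTop).2 ⟨⟨by linarith [hz.1.1], hz.1.2⟩, (mem_spaceCyl).2 ?_⟩
  simpa using ⟨hz.2.1.trans_lt h, hz.2.2.trans_lt h⟩

/-- Points of `[-ρ², 0] × {|x'| ≤ ρ, |x₃| ≤ ρ}` strictly below the top slice lie in `Q(r)`,
`ρ < r`. [folklore] -/
theorem mem_parCyl_of_mem_closedTop {ρ r : ℝ} (hρ : 0 ≤ ρ) (h : ρ < r)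
    {z : ℝ × EuclideanSpace ℝ (Fin 3)}
    (hz : z ∈ Icc (-ρ ^ 2) 0 ×ˢ {x : EuclideanSpace ℝ (Fin 3) | cylRadius x ≤ ρ ∧ |x 2| ≤ ρ})
    (ht : z.1 < 0) : z ∈ parCyl 0 r := by
  have h2 : ρ ^ 2 < r ^ 2 := pow_lt_pow_left₀ h hρ two_ne_zero
  rw [mem_parCyl_zero]
  exact ⟨⟨by linarith [hz.1.1], ht⟩, hz.2.1.trans_lt h, hz.2.2.trans_lt h⟩

/-- The half-closed cylinder `𝒞(R) × ]-R², 0]` lies in the closure of the open one: a top point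
`(0, y)` is the limit of `(s, y)`, `s → 0⁻`. [folklore] -/
theorem parCylTop_subset_closure_parCyl (R : ℝ) : parCylTop R ⊆ closure (parCyl 0 R) := by
  rintro ⟨t, x⟩ hz
  rw [mem_parCylTop] at hz
  obtain ⟨⟨h1, h2⟩, hx⟩ := hz
  have hx' : cylRadius x < R ∧ |x 2| < R := by simpa [mem_spaceCyl] using hx
  rcases h2.lt_or_eq with hlt | heq
  · exact subset_closure (mem_parCyl_zero.2 ⟨⟨h1, hlt⟩, hx'⟩)
  · subst heq
    have hR : (-R ^ 2 : ℝ) < 0 := h1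
    have hc : Continuous fun s : ℝ => ((s, x) : ℝ × EuclideanSpace ℝ (Fin 3)) :=
      continuous_id.prodMk continuous_const
    have ht : Tendsto (fun s : ℝ => ((s, x) : ℝ × EuclideanSpace ℝ (Fin 3))) (𝓝[<] 0)
        (𝓝 (0, x)) := (hc.tendsto 0).mono_left nhdsWithin_le_nhds
    refine mem_closure_of_tendsto ht ?_
    filter_upwards [Ioo_mem_nhdsLT hR] with s hs
    exact mem_parCyl_zero.2 ⟨hs, hx'⟩

/-- `[-ρ², 0] × {|x'| ≤ ρ, |x₃| ≤ ρ} ⊆ closure Q(r)` for `0 ≤ ρ < r`. [folklore] -/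
theorem closedTop_subset_closure_parCyl {ρ r : ℝ} (hρ : 0 ≤ ρ) (h : ρ < r) :
    Icc (-ρ ^ 2) 0 ×ˢ {x : EuclideanSpace ℝ (Fin 3) | cylRadius x ≤ ρ ∧ |x 2| ≤ ρ} ⊆
      closure (parCyl 0 r) :=
  (closedTop_subset_parCylTop hρ h).trans (parCylTop_subset_closure_parCyl r)

/-- Inside the closed half-space `{s ≤ 0} × ℝ³`, the compact cylinder-with-top of size `ρ` is a
neighbourhood of each of its "interior" points (`-ρ² < s`, `|x'| < ρ`, `|x₃| < ρ`). [folklore] -/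
theorem closedTop_mem_nhdsWithin {ρ : ℝ} {z : ℝ × EuclideanSpace ℝ (Fin 3)}
    (hz1 : -ρ ^ 2 < z.1) (hz2 : cylRadius z.2 < ρ) (hz3 : |z.2 2| < ρ) :
    Icc (-ρ ^ 2) 0 ×ˢ {x : EuclideanSpace ℝ (Fin 3) | cylRadius x ≤ ρ ∧ |x 2| ≤ ρ} ∈
      𝓝[Iic 0 ×ˢ univ] z := by
  have h1 : Continuous fun x : EuclideanSpace ℝ (Fin 3) => |x 2| := by fun_prop
  have hO : IsOpen (Ioi (-ρ ^ 2) ×ˢ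
      {x : EuclideanSpace ℝ (Fin 3) | cylRadius x < ρ ∧ |x 2| < ρ}) :=
    isOpen_Ioi.prod ((isOpen_lt continuous_cylRadius continuous_const).inter
      (isOpen_lt h1 continuous_const))
  refine mem_nhdsWithin.2 ⟨_, hO, ⟨hz1, hz2, hz3⟩, ?_⟩
  rintro w ⟨⟨hw1, hw2, hw3⟩, hw0, -⟩
  exact ⟨⟨le_of_lt hw1, hw0⟩, hw2.le, hw3.le⟩

/-- Every point admits a compact cylinder-with-top of integer size `n + 1` around it in the
sense of `closedTop_mem_nhdsWithin`. [folklore] -/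
theorem exists_nat_lt_closedTop (z : ℝ × EuclideanSpace ℝ (Fin 3)) :
    ∃ n : ℕ, -((n : ℝ) + 1) ^ 2 < z.1 ∧ cylRadius z.2 < (n : ℝ) + 1 ∧ |z.2 2| < (n : ℝ) + 1 := by
  obtain ⟨n, hn⟩ := exists_nat_gt (max (max (cylRadius z.2) |z.2 2|) |z.1|)
  have hn0 : (0 : ℝ) ≤ n := n.cast_nonneg
  refine ⟨n, ?_, ?_, ?_⟩
  · have h1 : |z.1| < n := lt_of_le_of_lt (le_max_right _ _) hn
    have h2 : -(n : ℝ) < z.1 := by linarith [(abs_lt.1 h1).1]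
    nlinarith
  · linarith [le_max_left (cylRadius z.2) |z.2 2|, le_max_left (max (cylRadius z.2) |z.2 2|) |z.1|]
  · linarith [le_max_right (cylRadius z.2) |z.2 2|, le_max_left (max (cylRadius z.2) |z.2 2|) |z.1|]

/-- A compact subset of the open half-space `{s < 0} × ℝ³` lies in `Q(n + 1)` for some `n ∈ ℕ`
(applied to the supports of the test fields of the limit). [folklore] -/
theorem exists_nat_subset_parCyl {K : Set (ℝ × EuclideanSpace ℝ (Fin 3))} (hK : IsCompact K)
    (hK0 : K ⊆ Iio 0 ×ˢ univ) : ∃ n : ℕ, K ⊆ parCyl 0 ((n : ℝ) + 1) := by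
  obtain ⟨r, hr⟩ := hK.isBounded.subset_closedBall 0
  obtain ⟨n, hn⟩ := exists_nat_gt r
  have hn0 : (0 : ℝ) ≤ n := n.cast_nonneg
  refine ⟨n, fun z hz => ?_⟩
  have hzr : ‖z‖ ≤ r := by simpa only [dist_zero_right] using mem_closedBall.1 (hr hz)
  have h1 : |z.1| ≤ r := by simpa only [Real.norm_eq_abs] using (norm_fst_le z).trans hzr
  have h2 : ‖z.2‖ ≤ r := (norm_snd_le z).trans hzr
  have ht : z.1 < 0 := (hK0 hz).1
  rw [mem_parCyl_zero]
  refine ⟨⟨?_, ht⟩, ?_, ?_⟩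
  · have h3 : -r ≤ z.1 := (abs_le.1 h1).1
    nlinarith
  · exact ((cylRadius_le_norm' z.2).trans h2).trans_lt (by linarith)
  · have h3 : |z.2 2| ≤ ‖z.2‖ := by simpa only [Real.norm_eq_abs] using PiLp.norm_apply_le z.2 2
    exact (h3.trans h2).trans_lt (by linarith)

/-- The space–time rotation `(s, y) ↦ (s, R_θ y)` preserves `Q(R)`. [folklore] -/
theorem mem_parCyl_rotZ_iff (θ R : ℝ) (z : ℝ × EuclideanSpace ℝ (Fin 3)) :
    (z.1, rotZ θ z.2) ∈ parCyl 0 R ↔ z ∈ parCyl 0 R := by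
  simp only [mem_parCyl_zero, cylRadius_rotZ, rotZ_apply_two]

/-- The space–time rotation `(s, y) ↦ (s, R_θ y)` preserves `𝒞(R) × ]-R², 0]`. [folklore] -/
theorem mem_parCylTop_rotZ_iff (θ R : ℝ) (z : ℝ × EuclideanSpace ℝ (Fin 3)) :
    (z.1, rotZ θ z.2) ∈ parCylTop R ↔ z ∈ parCylTop R := by
  simp only [mem_parCylTop, mem_spaceCyl, sub_zero, cylRadius_rotZ, rotZ_apply_two]

/-! ### From almost everywhere to everywhere for continuous representatives -/

/-- On an open set, an a.e. closed condition on a function continuous there holds at every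
point (the failure set is open and null, hence empty: Lebesgue measure charges non-empty open
sets). [folklore] -/
theorem forall_mem_of_ae_mem_of_continuousOn {X Y : Type*} [TopologicalSpace X]
    [MeasurableSpace X] [OpensMeasurableSpace X] {μ : Measure X} [μ.IsOpenPosMeasure]
    [TopologicalSpace Y] {U : Set X} (hU : IsOpen U) {f : X → Y} (hf : ContinuousOn f U)
    {C : Set Y} (hC : IsClosed C) (h : ∀ᵐ z ∂μ.restrict U, f z ∈ C) : ∀ z ∈ U, f z ∈ C := by
  by_contra hcon
  push Not at hcon
  obtain ⟨z, hzU, hz⟩ := hcon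
  have hopen : IsOpen (U ∩ f ⁻¹' Cᶜ) := hf.isOpen_inter_preimage hU hC.isOpen_compl
  have hpos : 0 < μ (U ∩ f ⁻¹' Cᶜ) := hopen.measure_pos μ ⟨z, hzU, hz⟩
  have hnull : μ.restrict U {w | ¬ f w ∈ C} = 0 := ae_iff.1 h
  rw [Measure.restrict_apply' hU.measurableSet] at hnull
  have hsub : U ∩ f ⁻¹' Cᶜ ⊆ {w | ¬ f w ∈ C} ∩ U := fun w hw => ⟨hw.2, hw.1⟩
  exact hpos.ne' (measure_mono_null hsub hnull)

section Representative

variable {R : ℝ} {U : ℝ → EuclideanSpace ℝ (Fin 3) → EuclideanSpace ℝ (Fin 3)}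
  {V : ℝ × EuclideanSpace ℝ (Fin 3) → EuclideanSpace ℝ (Fin 3)}

/-- **(p5) at every point.** If `|u^k| ≤ 1` a.e. on `Q(R)` and `V` is a representative continuous
on `𝒞(R) × ]-R², 0]`, then `|V| ≤ 1` at every point of `𝒞(R) × ]-R², 0]` (top slice included).
[cite: SereginSverak2009, §4 (p5) (arXiv p. 11)] -/
theorem norm_repr_le (hV : ContinuousOn V (parCylTop R))
    (hVU : V =ᵐ[volume.restrict (parCyl 0 R)] uncurry U)
    (hb : ∀ᵐ z ∂(volume.restrict (parCyl 0 R)), ‖U z.1 z.2‖ ≤ 1) :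
    ∀ z ∈ parCylTop R, ‖V z‖ ≤ 1 := by
  have hV' : ContinuousOn V (parCyl 0 R) := hV.mono (parCyl_zero_subset_parCylTop R)
  have h1 : ∀ᵐ z ∂(volume.restrict (parCyl 0 R)), V z ∈ closedBall (0 : EuclideanSpace ℝ (Fin 3)) 1 := by
    filter_upwards [hVU, hb] with z hz hbz
    rw [mem_closedBall_zero_iff, hz]
    exact hbz
  have h2 : ∀ z ∈ parCyl 0 R, V z ∈ closedBall (0 : EuclideanSpace ℝ (Fin 3)) 1 :=
    forall_mem_of_ae_mem_of_continuousOn (isOpen_parCyl 0 R) hV' isClosed_closedBall h1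
  intro z hz
  exact mem_closedBall_zero_iff.1 (mem_of_continuousOn_of_subset_closure hV
    (parCyl_zero_subset_parCylTop R) (parCylTop_subset_closure_parCyl R) isClosed_closedBall h2 z hz)

/-- **(p2)/(p10) at every point.** If `|y'| |u^k| ≤ A₂` a.e. on `Q(R)` and `V` is a representative
continuous on `𝒞(R) × ]-R², 0]`, then `|y'| |V| ≤ A₂` at every point of `𝒞(R) × ]-R², 0]`.
[cite: SereginSverak2009, §4 (p2), (p10) (arXiv p. 11)] -/
theorem cylRadius_mul_norm_repr_le (hV : ContinuousOn V (parCylTop R))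
    (hVU : V =ᵐ[volume.restrict (parCyl 0 R)] uncurry U) {A₂ : ℝ}
    (hb : ∀ᵐ z ∂(volume.restrict (parCyl 0 R)), cylRadius z.2 * ‖U z.1 z.2‖ ≤ A₂) :
    ∀ z ∈ parCylTop R, cylRadius z.2 * ‖V z‖ ≤ A₂ := by
  have hc : ContinuousOn (fun z : ℝ × EuclideanSpace ℝ (Fin 3) => cylRadius z.2 * ‖V z‖)
      (parCylTop R) :=
    (continuous_cylRadius.comp continuous_snd).continuousOn.mul hV.norm
  have h1 : ∀ᵐ z ∂(volume.restrict (parCyl 0 R)), cylRadius z.2 * ‖V z‖ ∈ Iic A₂ := by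
    filter_upwards [hVU, hb] with z hz hbz
    rw [mem_Iic, hz]
    exact hbz
  have h2 : ∀ z ∈ parCyl 0 R, cylRadius z.2 * ‖V z‖ ∈ Iic A₂ :=
    forall_mem_of_ae_mem_of_continuousOn (isOpen_parCyl 0 R)
      (hc.mono (parCyl_zero_subset_parCylTop R)) isClosed_Iic h1
  intro z hz
  exact mem_of_continuousOn_of_subset_closure hc (parCyl_zero_subset_parCylTop R)
    (parCylTop_subset_closure_parCyl R) isClosed_Iic h2 z hz

/-- **Axial symmetry at every point.** If every slice `u^k(s, ·)`, `-R² < s < 0`, is axisymmetric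
and `V` is a representative continuous on `𝒞(R) × ]-R², 0]`, then
`V(s, R_θ y) = R_θ V(s, y)` at every point of `𝒞(R) × ]-R², 0]`: the space–time rotation
`(s, y) ↦ (s, R_θ y)` preserves Lebesgue measure and `Q(R)`, so `V ∘ Φ_θ = R_θ ∘ V` a.e. on
`Q(R)`, hence everywhere there by continuity, and on the top slice by density.
[cite: SereginSverak2009, §4 ("we scale … so that scaled functions possess axial symmetry"; "u is … axially symmetric", arXiv p. 11)] -/
theorem repr_rotZ (hV : ContinuousOn V (parCylTop R))
    (hVU : V =ᵐ[volume.restrict (parCyl 0 R)] uncurry U)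
    (haxi : ∀ s ∈ Ioo (-R ^ 2) 0, IsAxisymmetric (U s)) (θ : ℝ) :
    ∀ z ∈ parCylTop R, V (z.1, rotZ θ z.2) = rotZ θ (V z) := by
  -- the space–time rotation and its invariances
  set Φ : ℝ × EuclideanSpace ℝ (Fin 3) → ℝ × EuclideanSpace ℝ (Fin 3) :=
    Prod.map id (rotZLIE θ) with hΦ_def
  have hΦ : ∀ z, Φ z = (z.1, rotZ θ z.2) := fun z => rfl
  have hΦc : Continuous Φ := continuous_id.prodMap (rotZLIE θ).continuous
  have hΦmp : MeasurePreserving Φ (volume : Measure (ℝ × EuclideanSpace ℝ (Fin 3))) volume :=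
    (MeasurePreserving.id (volume : Measure ℝ)).prod (rotZLIE θ).measurePreserving
  have hpre : Φ ⁻¹' parCyl 0 R = parCyl 0 R := by
    ext z
    rw [mem_preimage, hΦ, mem_parCyl_rotZ_iff]
  have hΦr : MeasurePreserving Φ (volume.restrict (parCyl 0 R)) (volume.restrict (parCyl 0 R)) := by
    have h := hΦmp.restrict_preimage (isOpen_parCyl (0 : ℝ × EuclideanSpace ℝ (Fin 3)) R).measurableSet
    rwa [hpre] at h
  have hmaps : MapsTo Φ (parCyl 0 R) (parCyl 0 R) := fun z hz => by
    rw [hΦ, mem_parCyl_rotZ_iff]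
    exact hz
  have hmapsT : MapsTo Φ (parCylTop R) (parCylTop R) := fun z hz => by
    rw [hΦ, mem_parCylTop_rotZ_iff]
    exact hz
  -- `V ∘ Φ = R_θ ∘ V` almost everywhere on `Q(R)`
  have h1 : (V ∘ Φ) =ᵐ[volume.restrict (parCyl 0 R)] (uncurry U ∘ Φ) :=
    hΦr.quasiMeasurePreserving.ae_eq_comp hVU
  have h2 : (uncurry U ∘ Φ) =ᵐ[volume.restrict (parCyl 0 R)] fun z => rotZ θ (uncurry U z) := by
    filter_upwards [ae_restrict_mem (isOpen_parCyl (0 : ℝ × EuclideanSpace ℝ (Fin 3)) R).measurableSet]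
      with z hz
    rw [mem_parCyl_zero] at hz
    simp only [comp_apply, hΦ, uncurry_apply_pair]
    exact haxi z.1 hz.1 θ z.2
  have h3 : (fun z => rotZ θ (uncurry U z)) =ᵐ[volume.restrict (parCyl 0 R)] fun z => rotZ θ (V z) := by
    filter_upwards [hVU] with z hz
    rw [hz]
  have hae : (V ∘ Φ) =ᵐ[volume.restrict (parCyl 0 R)] fun z => rotZ θ (V z) := (h1.trans h2).trans h3
  -- both sides are continuous on `Q(R)`, hence equal there
  have hcT1 : ContinuousOn (V ∘ Φ) (parCylTop R) := hV.comp hΦc.continuousOn hmapsT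
  have hcT2 : ContinuousOn (fun z => rotZ θ (V z)) (parCylTop R) :=
    (rotZLIE θ).continuous.comp_continuousOn hV
  have heq : EqOn (V ∘ Φ) (fun z => rotZ θ (V z)) (parCyl 0 R) :=
    Measure.eqOn_open_of_ae_eq hae (isOpen_parCyl 0 R)
      (hcT1.mono (parCyl_zero_subset_parCylTop R)) (hcT2.mono (parCyl_zero_subset_parCylTop R))
  -- and on the top slice by density
  have hpair : ContinuousOn (fun z => ((V ∘ Φ) z, rotZ θ (V z))) (parCylTop R) := hcT1.prodMk hcT2
  have key := mem_of_continuousOn_of_subset_closure hpair (parCyl_zero_subset_parCylTop R)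
    (parCylTop_subset_closure_parCyl R) isClosed_diagonal (fun z hz => heq hz)
  intro z hz
  have := key z hz
  rwa [mem_diagonal_iff, comp_apply, hΦ] at this

/-- **Pointwise axial symmetry of the slices of the representative.** In the form consumed by
`ae_rotZ_of_isAxisymmetric`: every slice `V(s, ·)` with `-R² < s ≤ 0` is axisymmetric on `𝒞(R)`.
[cite: SereginSverak2009, §4 (arXiv p. 11)] -/
theorem repr_rotZ' (hV : ContinuousOn V (parCylTop R))
    (hVU : V =ᵐ[volume.restrict (parCyl 0 R)] uncurry U)
    (haxi : ∀ s ∈ Ioo (-R ^ 2) 0, IsAxisymmetric (U s)) (θ : ℝ) {s : ℝ}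
    {y : EuclideanSpace ℝ (Fin 3)} (h : (s, y) ∈ parCylTop R) :
    V (s, rotZ θ y) = rotZ θ (V (s, y)) :=
  repr_rotZ hV hVU haxi θ (s, y) h

/-! ### The Hölder modulus on the compact cylinders-with-top -/

/-- **From a Hölder representative on `Q(r)` to a modulus for `V` on the compact cylinder of size
`ρ < r`.** If some function `V'` a.e. equal to `u` on `Q(r)` is `α`-Hölder with constant `K` on
`Q(r)` (the output of `LocalHolderBound`), and `V` is a representative of `u` continuous on
`𝒞(R) × ]-R², 0]`, `r ≤ R`, then `V = V'` on `Q(r)` and, by continuity up to the top slice,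
`dist (V z) (V z') ≤ K dist(z, z')^α` on `[-ρ², 0] × {|x'| ≤ ρ, |x₃| ≤ ρ}` for every
`0 ≤ ρ < r`. [cite: SereginSverak2009, §4 ("uniformly bounded in the parabolic Hölder space C^{1/2}(Q̄(a/2))", arXiv p. 11)] -/
theorem dist_repr_le_of_holderOnWith (hV : ContinuousOn V (parCylTop R)) {r : ℝ} (hrR : r ≤ R)
    (hVU : V =ᵐ[volume.restrict (parCyl 0 r)] uncurry U)
    {V' : ℝ × EuclideanSpace ℝ (Fin 3) → EuclideanSpace ℝ (Fin 3)}
    (hV'U : V' =ᵐ[volume.restrict (parCyl 0 r)] uncurry U) {K α : ℝ≥0} (hα : 0 < α)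
    (hH : HolderOnWith K α V' (parCyl 0 r)) {ρ : ℝ} (hρ : 0 ≤ ρ) (hρr : ρ < r) :
    ∀ z ∈ Icc (-ρ ^ 2) 0 ×ˢ {x : EuclideanSpace ℝ (Fin 3) | cylRadius x ≤ ρ ∧ |x 2| ≤ ρ},
      ∀ z' ∈ Icc (-ρ ^ 2) 0 ×ˢ {x : EuclideanSpace ℝ (Fin 3) | cylRadius x ≤ ρ ∧ |x 2| ≤ ρ},
        dist (V z) (V z') ≤ K * dist z z' ^ (α : ℝ) := by
  have hr0 : 0 ≤ r := hρ.trans hρr.le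
  have hsub : parCyl 0 r ⊆ parCylTop R :=
    (parCyl_mono 0 hr0 hrR).trans (parCyl_zero_subset_parCylTop R)
  have hVc : ContinuousOn V (parCyl 0 r) := hV.mono hsub
  have heq : EqOn V' V (parCyl 0 r) :=
    Measure.eqOn_open_of_ae_eq (hV'U.trans hVU.symm) (isOpen_parCyl 0 r) (hH.continuousOn hα) hVc
  -- the modulus for `V` on the open cylinder
  have hD : ∀ z ∈ parCyl 0 r, ∀ z' ∈ parCyl 0 r, dist (V z) (V z') ≤ K * dist z z' ^ (α : ℝ) := by
    intro z hz z' hz'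
    rw [← heq hz, ← heq hz']
    exact hH.dist_le hz hz'
  -- extend to `Q(r) ∪ T` by continuity (`T` the compact cylinder-with-top of size `ρ`)
  set T : Set (ℝ × EuclideanSpace ℝ (Fin 3)) :=
    Icc (-ρ ^ 2) 0 ×ˢ {x : EuclideanSpace ℝ (Fin 3) | cylRadius x ≤ ρ ∧ |x 2| ≤ ρ} with hT
  have hTtop : T ⊆ parCylTop R :=
    (closedTop_subset_parCylTop hρ (hρr.trans_le hrR))
  have hS : ContinuousOn V (parCyl 0 r ∪ T) := hV.mono (union_subset hsub hTtop)
  have hcl : parCyl 0 r ∪ T ⊆ closure (parCyl 0 r) :=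
    union_subset subset_closure (closedTop_subset_closure_parCyl hρ hρr)
  have key := dist_le_mul_rpow_of_subset_closure hS subset_union_left hcl
    (by exact_mod_cast hα) hD
  intro z hz z' hz'
  exact key z (Or.inr hz) z' (Or.inr hz')

end Representative

end SereginSverak2009

end Literature.Analysis.FluidPDE
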